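import Mathlib
import Literature.MathematicalPhysics.QuantumFieldTheory.Balaban1983to89.B12ContourAverage253

/-!
# `Balaban1983to89.B12Average05And08` — [Balaban1987RG1] (0.5) «M({U_j⁻¹}) = M({U_j})⁻¹» and a quantitative
# (0.8) «(1/i) log M({exp iA_j}) = (1/n) Σ_j A_j + (higher order terms)» PROVED for the b12 lineage's CONCRETE
# mean `B12ContourAverage253.fedAvg` (Federbush's (0.10) by a base point) in any complete normed `ℂ`-algebra,
# and (0.5) for the contour family: the factor `𝐔(x′, c₊)` of (0.12) IS `𝐔(c₊, x′)⁻¹`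

HONEST FRAMING (cell `lit-balaban`, verbatim): statement-level skeleton of published theorems with citation tags;
proofs where landed; nothing here is a claim about the Yang–Mills mass gap.

CITATION HEADER.  T. Bałaban, *Renormalization group approach to lattice gauge field theories. I*, Commun. Math.
Phys. **109** (1987) 249–301, doi:10.1007/bf01215223 [Balaban1987RG1] (cell paper B12 = «[I]»).  PDF held:
`paper:balaban1987-cmp109-rg-i-small-field` (journal page = PDF page + 248); p. 253 [PDF 5] and p. 254 [PDF 6]
re-read this generation from the held text.  The second-order product rule for the logarithm is the mechanism of
[B7] = [Balaban1985Averaging] (21)–(25) p. 21 and (26)–(27) p. 22, used through the tree (`FederbushMean.mlog_mul_sub_sub_eq`,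
`norm_mlog_sub_sub_one_le_of_le`).  Unit `lit-balaban-r09` gen 9 (display owner of CMP 109; TAKING line
`HOME/STATUS.md` 2026-08-21T08:5xZ), HOME `run/shared/lean/pub/lit-balaban/`; SKELETON rows `B12.Eq0.5`,
`B12.Eq0.8`, `B12.Eq0.11`, `B12.Eq0.12` (cells only).

WHAT IS PRINTED (verbatim, p. 253).  *«We denote it by M({U_j}), and we assume that it is an analytic function
having the following properties: M({U_j⁻¹}) = M({U_j})⁻¹; (0.5) … for a set {U_j} of elements close to the
identity of the group, i.e. U_j = exp iA_j with A_j in a small neighborhood of 0 in gᶜ, the average is close to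
the identity also, and (1/i) log M({exp iA_j}) = (1/n) Σ_{j=1}^{n} A_j + (higher order terms); (0.8) … This
definition [(0.10)] has all the properties listed above, as it was proved by Federbush in [35 (II)].»*  p. 254,
(0.12): the loop `𝐔(c₋,x)U([x, x + L e_μ])𝐔(x + L e_μ, c₊)U(c)⁻¹` uses the REVERSED averaged variable `𝐔(x′, c₊)`.

DICTIONARY print → Lean (all PRE-EXISTING).  `M({𝐔_j})` ↦ `B12ContourAverage253.fedAvg F j₀ = (fedUnit (rel F
j₀))⁻¹ · F j₀` (Federbush's (0.10) solved by the tree's `FederbushMean.fedSol` for the relative family `rel F j₀ j =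
F_j F_{j₀}⁻¹`); `log` ↦ the series logarithm `MatrixLog.mlog`; «elements close to the identity» ↦ `U1`-valued
(`‖F_j‖, ‖F_j⁻¹‖ ≤ 1`) with `‖F_j − 1‖ ≤ δ`; (0.11) `𝐔(q,x)` ↦ `B12ContourAverage253.Tavg` (family
`B12ContourAverage253.permT L U · x` over `π ∈ Perm(Fin d)`, base `π = 1`).

THE ARGUMENT FORMALISED.  (0.5) (`fedAvg_inv_family`): write `X = fedSol {F_jF₀⁻¹}` (`Σ_j log(F_jF₀⁻¹X) = 0`,
`M = X⁻¹F₀`).  The inverted family has relative family `F_j⁻¹F₀ = (F₀⁻¹F_j)⁻¹`, again `δ`-small, and the candidate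
`Y = F₀⁻¹X⁻¹F₀` satisfies `F_j⁻¹F₀·Y = F₀⁻¹(XF_jF₀⁻¹)⁻¹F₀`, so `log(F_j⁻¹F₀Y) = −F₀⁻¹·X·log(F_jF₀⁻¹X)·X⁻¹·F₀`
(`log V⁻¹ = −log V`, `ExpMeanLog.mlog_eq_neg_of_mul_eq_one`; conjugation by the contraction `F₀⁻¹`,
`B7Prop1Explicit.mlog_units_conj`; conjugation by the NON-contraction `X`, § 1 `mlog_conj_units` — termwise on
the series, both radii `< 1`), whence `Σ_j log(F_j⁻¹F₀Y) = 0`; `‖Y − 1‖ ≤ 4δ ≤ 2/25`, so by the tree's local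
uniqueness `FederbushMean.fedSol_unique` `Y` IS the solution for the inverted family and `M({F_j⁻¹}) = Y⁻¹F₀⁻¹ =
F₀⁻¹X = M({F_j})⁻¹`.  (0.8) (`norm_mlog_fedAvg_sub_mean_le`): `log M = log(X⁻¹F₀) = −log X + log F₀ + O((9δ)²)`
(§ 3 product rule `norm_mlog_mul_sub_le`: `‖log(WX) − log W − log X‖ ≤ 4(p+q)²`), `−log X = n⁻¹Σ_j log(F_jF₀⁻¹) +
O(35(2δ)²)` (the tree's `FederbushMean.norm_mlog_fedSol_add_fed_one_le`), `log(F_jF₀⁻¹) = log F_j − log F₀ +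
O(4(2δ)²)`; total `≤ 500δ²`.  § 4 (`fedAvg_permT_inv`): (0.5) for the contour family of (0.11) on an `ε₀`-regular
`U1`-valued configuration (`B12ContourAverage253.rel_permT_small`, `(dL)²ε₀ ≤ 1/100`).

WHAT IS PROVED (kernel-checked, no `sorry`, axioms `propext`, `Classical.choice`, `Quot.sound`; NO definition, NO
`Prop` placeholder, net new unproved facts 0): `mlog_conj_units`, **`fedAvg_inv_family`** ((0.5)),
`norm_mlog_mul_sub_le`, **`norm_mlog_fedAvg_sub_mean_le`** ((0.8), constant `500`, radius `δ ≤ 1/200`),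
**`fedAvg_permT_inv`** (`M({U(Γ)⁻¹}_{Γ∈𝐆(q,x)}) = 𝐔(q,x)⁻¹`).

DIVERGENCES FROM PRINT / WHAT IS NOT PROVED (honest scope).  (a) The mean is the lineage's base-point realisation
of (0.10) (`B12ContourAverage253` DIVERGENCE (c)); print's `M` is an abstract analytic `Gᶜ`-valued function with
(0.5)–(0.9) as axioms — here (0.5) and (0.8) are THEOREMS about that realisation ((0.6) one- and two-sided:
`B12ContourAverage253.fedAvg_mul_right`, `B12Average012Covariance`; (0.7): `fedAvg_perm`/`fedAvg_base_indep`; (0.9):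
`B12Average012Prop2.fedSol_mem_unitary`, `avgBar_mem_unitaryUnits`).  (b) (0.8) is print's «(higher order terms)»
made quantitative with the FILE's constant `500` and radius `1/200`, for `U1`-valued families `δ`-close to `1` in
norm (print: `A_j` in a small neighbourhood of `0 ∈ gᶜ`; no `Gᶜ`, no analyticity here); the `1/i` and the
Lie-algebra reading of `log` are not separated (series logarithm in `𝔸`).  (c) § 4 turns the lineage's READING
(f) of `𝐔(x′, c₊)` as `𝐔(c₊, x′)⁻¹` (`B12ContourAverage253`, `B12AverageCorridor267.loopW`) into a consequence of
(0.5) for the reversed family `{U(−Γ) = U(Γ)⁻¹}`; that `𝐆(x′, c₊)` consists of the reversed contours of `𝐆(c₊, x′)`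
is print's convention (p. 252), not a Lean statement.  (d) Weak inequalities; `ℤᵈ` corner-cube geometry of the
lineage as in `B12ContourAverage253` (a).

DOCFIX (unit `lit-balaban-r09` gen 13): the [Balaban1985Averaging] locator of `norm_mlog_mul_sub_le` «(26)–(27) p.21» → «(26)–(27) p.22» and the header's «(21)–(27) p. 21» → «(21)–(25) p. 21 and (26)–(27) p. 22» (CMP 98 p. 21 ends with (25), p. 22 opens with (26)–(27); CITELOC rows P31-115/P31-121 of `pub-balaban` summit-lit1, re-read on the page images `…/1985-cmp98-averaging-p005-x2.png`, `-p006-x2.png` by this seat); no declaration, statement or proof changed.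
-/

noncomputable section

open NormedSpace Finset

namespace Literature.MathematicalPhysics.QuantumFieldTheory.Balaban1983to89.B12Average05And08

open Literature.MathematicalPhysics.QuantumLattice (ZdEdge blockMap blockBase blockSites mem_blockSites_iff
  plaquetteHolonomyZd)
open B7Prop1Explicit (U1 mem_U1 norm_units_conj_sub_one_le norm_inv_sub_one_le mlog_units_conj)
open B12HOperator267 (gammaT)
open B12ContourAverage253 (rel fedUnit val_fedUnit fedAvg fedAvg_mul_inv permT permT_one Tavg Tavg_eq
  rel_permT_small permT_mem_U1 norm_fedAvg_mul_inv_sub_one_le)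
open FederbushMean (fed fed_def fedSol fedSol_unique sum_mlog_mul_fedSol norm_fedSol_sub_one_le norm_mul_sub_one_le
  mlog_mul_sub_sub_eq norm_mlog_sub_sub_one_le_of_le norm_mlog_fedSol_add_fed_one_le norm_avg_le avg_const
  isUnit_and_norm_inverse_sub_one_le)
open MatrixLog (mlog mlog_one hasSum_mlog)

variable {d : ℕ}

section Mean

variable {𝔸 : Type*} [NormedRing 𝔸] [NormedAlgebra ℂ 𝔸] [NormOneClass 𝔸] [CompleteSpace 𝔸]
variable {ι : Type*} [Fintype ι] [Nonempty ι]

/-! ## § 1  The series logarithm under conjugation by an ARBITRARY unit -/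

omit [NormOneClass 𝔸] [Fintype ι] [Nonempty ι] in
/-- [cite: Balaban1985Averaging, (21)–(23) p.21] `log(P Z P⁻¹) = P (log Z) P⁻¹` for the series logarithm whenever
both series converge (`‖Z − 1‖ < 1`, `‖PZP⁻¹ − 1‖ < 1`) — termwise conjugation; no norm condition on `P`
(`B7Prop1Explicit.mlog_units_conj` is the case `‖P‖, ‖P⁻¹‖ ≤ 1`). -/
theorem mlog_conj_units {P : 𝔸ˣ} {Z : 𝔸} (hZ : ‖Z - 1‖ < 1)
    (hPZ : ‖(P : 𝔸) * Z * ((P⁻¹ : 𝔸ˣ) : 𝔸) - 1‖ < 1) :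
    mlog ((P : 𝔸) * Z * ((P⁻¹ : 𝔸ˣ) : 𝔸)) = (P : 𝔸) * mlog Z * ((P⁻¹ : 𝔸ˣ) : 𝔸) := by
  have hc : (P : 𝔸) * Z * ((P⁻¹ : 𝔸ˣ) : 𝔸) - 1 = (P : 𝔸) * (Z - 1) * ((P⁻¹ : 𝔸ˣ) : 𝔸) := by
    rw [mul_sub, sub_mul, mul_one, Units.mul_inv]
  have h1 := hasSum_mlog hPZ
  have h2 := ((hasSum_mlog hZ).mul_left (P : 𝔸)).mul_right ((P⁻¹ : 𝔸ˣ) : 𝔸)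
  have h3 : (fun n : ℕ => Literature.Analysis.Complex.logSeriesCoeff n • ((P : 𝔸) * Z * ((P⁻¹ : 𝔸ˣ) : 𝔸) - 1) ^ n)
      = fun n : ℕ => (P : 𝔸) * (Literature.Analysis.Complex.logSeriesCoeff n • (Z - 1) ^ n) * ((P⁻¹ : 𝔸ˣ) : 𝔸) := by
    funext n
    rw [hc, Units.conj_pow, mul_smul_comm, smul_mul_assoc]
  rw [h3] at h1
  exact h1.unique h2

omit [NormedAlgebra ℂ 𝔸] [NormOneClass 𝔸] [Fintype ι] [Nonempty ι] in
/-- [folklore] the inverse of a unit within `t < 1` of `1` is within `t/(1 − t)` of `1` (Neumann series). -/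
private theorem norm_units_inv_sub_one_le {V : 𝔸ˣ} {t : ℝ} (hV : ‖(V : 𝔸) - 1‖ ≤ t) (ht : t < 1) :
    ‖((V⁻¹ : 𝔸ˣ) : 𝔸) - 1‖ ≤ t / (1 - t) := by
  have h := (isUnit_and_norm_inverse_sub_one_le hV ht).2
  rwa [Ring.inverse_unit] at h

/-! ## § 2  (0.5): the mean of the inverted family is the inverse of the mean -/

/-- [cite: Balaban1987RG1, (0.5) p.253] **(0.5) «M({𝐔_j⁻¹}) = M({𝐔_j})⁻¹» FOR THE LINEAGE'S CONCRETE MEAN**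
(`B12ContourAverage253.fedAvg`, Federbush's (0.10) by the base point `j₀`) on `U1`-valued families of relative
diameter `δ ≤ 1/100` in a complete normed `ℂ`-algebra (no adjoints needed; the tree's unitary-matrix version is
`BlockAveragingFederbush.fedM_star`).  Proof: with `X = fedSol (𝐔_j𝐔₀⁻¹)`, `Σ_j log(𝐔_j𝐔₀⁻¹X) = 0`, the element
`Y = 𝐔₀⁻¹X⁻¹𝐔₀` solves (0.10) for the inverted family, `Σ_j log(𝐔_j⁻¹𝐔₀·Y) = −𝐔₀⁻¹X[Σ_j log(𝐔_j𝐔₀⁻¹X)]X⁻¹𝐔₀ = 0`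
(`log V⁻¹ = −log V`, conjugation § 1), and lies in the uniqueness ball (`FederbushMean.fedSol_unique`). -/
theorem fedAvg_inv_family {δ : ℝ} (hδ : δ ≤ 1 / 100) {F : ι → 𝔸ˣ} (hF : ∀ j, F j ∈ U1 𝔸) {j₀ : ι}
    (h : ∀ j, ‖rel F j₀ j - 1‖ ≤ δ) :
    fedAvg (fun j => (F j)⁻¹) j₀ = (fedAvg F j₀)⁻¹ := by
  have hδ0 : 0 ≤ δ := (norm_nonneg _).trans (h j₀)
  set W : ι → 𝔸 := rel F j₀ with hWdef
  have hW : ∀ j, ‖W j - 1‖ ≤ 1 / 100 := fun j => (h j).trans hδ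
  set u : 𝔸ˣ := fedUnit W with hudef
  have hX : ‖(u : 𝔸) - 1‖ ≤ 3 * δ := by rw [hudef, val_fedUnit]; exact norm_fedSol_sub_one_le hδ h
  have huinv : ‖((u⁻¹ : 𝔸ˣ) : 𝔸) - 1‖ ≤ 4 * δ := by
    have := norm_fedAvg_mul_inv_sub_one_le hδ (F := F) (j₀ := j₀) h
    rwa [fedAvg_mul_inv] at this
  have hF0 : (F j₀)⁻¹ ∈ U1 𝔸 := (U1 𝔸).inv_mem (hF j₀)
  -- the relative family of the inverted family: `W′_j = 𝐔_j⁻¹𝐔₀ = (𝐔₀⁻¹𝐔_j)⁻¹`, again `δ`-small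
  set W' : ι → 𝔸 := rel (fun j => (F j)⁻¹) j₀ with hW'def
  have hW'eq : ∀ j, W' j = (((F j)⁻¹ * F j₀ : 𝔸ˣ)) := fun j => by
    simp only [hW'def, rel, inv_inv, Units.val_mul]
  have hW' : ∀ j, ‖W' j - 1‖ ≤ 1 / 100 := by
    intro j
    rw [hW'eq, show (F j)⁻¹ * F j₀ = ((F j₀)⁻¹ * (F j * (F j₀)⁻¹) * ((F j₀)⁻¹)⁻¹)⁻¹ by group]
    refine (norm_inv_sub_one_le ((U1 𝔸).mul_mem ((U1 𝔸).mul_mem hF0 ((U1 𝔸).mul_mem (hF j) hF0))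
      ((U1 𝔸).inv_mem hF0))).trans ?_
    rw [Units.val_mul, Units.val_mul]
    refine (norm_units_conj_sub_one_le hF0 _).trans ?_
    have : ((F j * (F j₀)⁻¹ : 𝔸ˣ) : 𝔸) = W j := by simp only [hWdef, rel, Units.val_mul]
    rw [this]
    exact hW j
  -- the candidate `Y = 𝐔₀⁻¹ X⁻¹ 𝐔₀`
  set Yu : 𝔸ˣ := (F j₀)⁻¹ * u⁻¹ * ((F j₀)⁻¹)⁻¹ with hYudef
  have hY : ‖(Yu : 𝔸) - 1‖ ≤ 2 / 25 := by
    rw [hYudef, Units.val_mul, Units.val_mul]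
    exact (norm_units_conj_sub_one_le hF0 _).trans (huinv.trans (by linarith))
  -- `W′_j · Y = 𝐔₀⁻¹ (X W_j)⁻¹ 𝐔₀` with `X W_j = u 𝐔_j 𝐔₀⁻¹`
  have hprod : ∀ j, W' j * (Yu : 𝔸)
      = (((F j₀)⁻¹ : 𝔸ˣ) : 𝔸) * (((u * (F j * (F j₀)⁻¹))⁻¹ : 𝔸ˣ) : 𝔸) * ((((F j₀)⁻¹)⁻¹ : 𝔸ˣ) : 𝔸) := by
    intro j
    rw [hW'eq, hYudef, ← Units.val_mul, ← Units.val_mul, ← Units.val_mul]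
    congr 1
    group
  -- smallness of `X W_j` and `W_j X`
  have hXW : ∀ j, ‖((u * (F j * (F j₀)⁻¹) : 𝔸ˣ) : 𝔸) - 1‖ ≤ 1 / 20 := fun j => by
    rw [Units.val_mul, show ((F j * (F j₀)⁻¹ : 𝔸ˣ) : 𝔸) = W j by simp only [hWdef, rel, Units.val_mul]]
    exact (norm_mul_sub_one_le hX (h j)).trans (by nlinarith)
  have hWX : ∀ j, ‖W j * (u : 𝔸) - 1‖ ≤ 1 / 20 := fun j =>
    (norm_mul_sub_one_le (h j) hX).trans (by nlinarith)
  have hXWinv : ∀ j, ‖(((u * (F j * (F j₀)⁻¹))⁻¹ : 𝔸ˣ) : 𝔸) - 1‖ < 1 := fun j =>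
    (norm_units_inv_sub_one_le (hXW j) (by norm_num)).trans_lt (by norm_num)
  -- the logarithms: `log(W′_j Y) = −𝐔₀⁻¹ · u · log(W_j X) · u⁻¹ · 𝐔₀`
  have hlog : ∀ j, mlog (W' j * (Yu : 𝔸))
      = -((((F j₀)⁻¹ : 𝔸ˣ) : 𝔸) * ((u : 𝔸) * mlog (W j * (u : 𝔸)) * ((u⁻¹ : 𝔸ˣ) : 𝔸))
          * ((((F j₀)⁻¹)⁻¹ : 𝔸ˣ) : 𝔸)) := by
    intro j
    rw [hprod j, mlog_units_conj hF0 (hXWinv j),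
      ExpMeanLog.mlog_eq_neg_of_mul_eq_one (Units.mul_inv _) ((hXW j).trans (by norm_num))]
    have hconj : ((u * (F j * (F j₀)⁻¹) : 𝔸ˣ) : 𝔸) = (u : 𝔸) * (W j * (u : 𝔸)) * ((u⁻¹ : 𝔸ˣ) : 𝔸) := by
      rw [Units.val_mul, show ((F j * (F j₀)⁻¹ : 𝔸ˣ) : 𝔸) = W j by simp only [hWdef, rel, Units.val_mul],
        mul_assoc, mul_assoc, Units.mul_inv, mul_one]
    rw [hconj, mlog_conj_units ((hWX j).trans_lt (by norm_num)) (by rw [← hconj]; exact (hXW j).trans_lt (by norm_num))]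
    simp only [mul_neg, neg_mul]
  have hfY : fed W' (Yu : 𝔸) = 0 := by
    have h0 := sum_mlog_mul_fedSol hW
    have h0' : ∑ j, mlog (W j * (u : 𝔸)) = 0 := by rw [hudef, val_fedUnit]; exact h0
    rw [fed_def]
    simp only [hlog, sum_neg_distrib, ← Finset.sum_mul, ← Finset.mul_sum, h0', mul_zero, zero_mul, neg_zero,
      smul_zero]
  have hsol : fedSol W' = (Yu : 𝔸) := (fedSol_unique hW' hY hfY).symm
  have hunit : fedUnit W' = Yu := Units.ext (by rw [val_fedUnit, hsol])
  show (fedUnit W')⁻¹ * (F j₀)⁻¹ = ((fedUnit W)⁻¹ * F j₀)⁻¹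
  rw [hunit, hYudef, ← hudef]
  group

/-! ## § 3  (0.8): to first order the mean is the arithmetic mean of the logarithms -/

omit [NormOneClass 𝔸] [Fintype ι] [Nonempty ι] in
/-- [cite: Balaban1985Averaging, (26)–(27) p.22] the logarithm of a product to second order:
`‖log(WX) − log W − log X‖ ≤ 4(p + q)²` for `‖W − 1‖ ≤ p ≤ 1/10`, `‖X − 1‖ ≤ q ≤ 1/10`
(`FederbushMean.mlog_mul_sub_sub_eq`). -/
theorem norm_mlog_mul_sub_le {W X : 𝔸} {p q : ℝ} (hW : ‖W - 1‖ ≤ p) (hX : ‖X - 1‖ ≤ q) (hp : p ≤ 1 / 10)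
    (hq : q ≤ 1 / 10) : ‖mlog (W * X) - mlog W - mlog X‖ ≤ 4 * (p + q) ^ 2 := by
  have hp0 : 0 ≤ p := (norm_nonneg _).trans hW
  have hq0 : 0 ≤ q := (norm_nonneg _).trans hX
  have hWX : ‖W * X - 1‖ ≤ p * q + p + q := norm_mul_sub_one_le hW hX
  have hpq : p * q ≤ (p + q) / 20 := by nlinarith
  have hs0 : 0 ≤ p * q + p + q := by positivity
  have hs' : p * q + p + q ≤ 21 / 20 * (p + q) := by linarith
  have hs : p * q + p + q ≤ 21 / 100 := by nlinarith
  have h1 := norm_mlog_sub_sub_one_le_of_le hWX (by linarith)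
  have h2 := norm_mlog_sub_sub_one_le_of_le hW (by linarith)
  have h3 := norm_mlog_sub_sub_one_le_of_le hX (by linarith)
  have h4 : ‖(W - 1) * (X - 1)‖ ≤ p * q := (norm_mul_le _ _).trans (mul_le_mul hW hX (norm_nonneg _) hp0)
  have h1' : (p * q + p + q) / (1 - (p * q + p + q)) * (p * q + p + q) ≤ 2 * (p + q) ^ 2 := by
    rw [div_mul_eq_mul_div, div_le_iff₀ (by nlinarith)]
    have h1s : 79 / 100 ≤ 1 - (p * q + p + q) := by linarith
    have hss := mul_le_mul hs' hs' hs0 (by positivity)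
    nlinarith [mul_le_mul_of_nonneg_left h1s (by positivity : (0 : ℝ) ≤ 2 * (p + q) ^ 2)]
  have h2' : p / (1 - p) * p ≤ 6 / 5 * p ^ 2 := by
    rw [div_mul_eq_mul_div, div_le_iff₀ (by nlinarith)]; nlinarith
  have h3' : q / (1 - q) * q ≤ 6 / 5 * q ^ 2 := by
    rw [div_mul_eq_mul_div, div_le_iff₀ (by nlinarith)]; nlinarith
  rw [mlog_mul_sub_sub_eq]
  calc _ ≤ ‖mlog (W * X) - (W * X - 1)‖ + ‖mlog W - (W - 1)‖ + ‖mlog X - (X - 1)‖ + ‖(W - 1) * (X - 1)‖ :=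
        (norm_add_le _ _).trans (add_le_add ((norm_sub_le _ _).trans (add_le_add (norm_sub_le _ _) le_rfl)) le_rfl)
    _ ≤ 2 * (p + q) ^ 2 + 6 / 5 * p ^ 2 + 6 / 5 * q ^ 2 + p * q := by linarith
    _ ≤ 4 * (p + q) ^ 2 := by nlinarith [mul_nonneg hp0 hq0]

/-- [cite: Balaban1987RG1, (0.8) p.253] **(0.8) «(1/i) log M({exp iA_j}) = (1/n) Σ_j A_j + (higher order terms)» FOR
THE LINEAGE'S CONCRETE MEAN, QUANTIFIED**: for a `U1`-valued family with `‖𝐔_j − 1‖ ≤ δ ≤ 1/200`,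
`‖log M({𝐔_j}) − (1/n) Σ_j log 𝐔_j‖ ≤ 500·δ²` (`M = B12ContourAverage253.fedAvg · j₀`, any base point; series
logarithm; from the tree's quantitative (0.8) for the solution of (0.10), `FederbushMean.norm_mlog_fedSol_add_fed_one_le`,
and § 3's second-order product rule). -/
theorem norm_mlog_fedAvg_sub_mean_le {δ : ℝ} (hδ : δ ≤ 1 / 200) {F : ι → 𝔸ˣ} (hF : ∀ j, F j ∈ U1 𝔸)
    (hF1 : ∀ j, ‖((F j : 𝔸ˣ) : 𝔸) - 1‖ ≤ δ) (j₀ : ι) :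
    ‖mlog ((fedAvg F j₀ : 𝔸ˣ) : 𝔸) - (Fintype.card ι : ℂ)⁻¹ • ∑ j, mlog ((F j : 𝔸ˣ) : 𝔸)‖ ≤ 500 * δ ^ 2 := by
  have hδ0 : 0 ≤ δ := (norm_nonneg _).trans (hF1 j₀)
  have hF0 : (F j₀)⁻¹ ∈ U1 𝔸 := (U1 𝔸).inv_mem (hF j₀)
  have hF0inv : ‖(((F j₀)⁻¹ : 𝔸ˣ) : 𝔸) - 1‖ ≤ δ := (norm_inv_sub_one_le (hF j₀)).trans (hF1 j₀)
  set W : ι → 𝔸 := rel F j₀ with hWdef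
  -- the relative family is `2δ`-small
  have hW : ∀ j, ‖W j - 1‖ ≤ 2 * δ := by
    intro j
    have hWj : W j = (F j : 𝔸) * (((F j₀)⁻¹ : 𝔸ˣ) : 𝔸) := rfl
    have e : W j - 1 = (((F j : 𝔸) - 1) - ((F j₀ : 𝔸) - 1)) * (((F j₀)⁻¹ : 𝔸ˣ) : 𝔸) := by
      rw [hWj, sub_sub_sub_cancel_right, sub_mul, Units.mul_inv]
    rw [e]
    calc _ ≤ ‖((F j : 𝔸) - 1) - ((F j₀ : 𝔸) - 1)‖ * ‖(((F j₀)⁻¹ : 𝔸ˣ) : 𝔸)‖ := norm_mul_le _ _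
      _ ≤ (δ + δ) * 1 := mul_le_mul ((norm_sub_le _ _).trans (add_le_add (hF1 j) (hF1 j₀))) hF0.1
          (norm_nonneg _) (by linarith)
      _ = 2 * δ := by ring
  have h2δ : 2 * δ ≤ 1 / 100 := by linarith
  set u : 𝔸ˣ := fedUnit W with hudef
  have hX : ‖(u : 𝔸) - 1‖ ≤ 3 * (2 * δ) := by rw [hudef, val_fedUnit]; exact norm_fedSol_sub_one_le h2δ hW
  have huinv : ‖((u⁻¹ : 𝔸ˣ) : 𝔸) - 1‖ ≤ 4 * (2 * δ) := by
    have := norm_fedAvg_mul_inv_sub_one_le h2δ (F := F) (j₀ := j₀) hW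
    rwa [fedAvg_mul_inv] at this
  -- (a) the tree's quantitative (0.8) for `X`: `‖log X + n⁻¹ Σ log W_j‖ ≤ 35(2δ)²`
  have ha := norm_mlog_fedSol_add_fed_one_le h2δ hW
  have hfed1 : fed W 1 = (Fintype.card ι : ℂ)⁻¹ • ∑ j, mlog (W j) := by simp only [fed_def, mul_one]
  -- (b) `log M = log(X⁻¹ 𝐔₀) ≈ log X⁻¹ + log 𝐔₀`, `log X⁻¹ = −log X`
  have hM : ((fedAvg F j₀ : 𝔸ˣ) : 𝔸) = ((u⁻¹ : 𝔸ˣ) : 𝔸) * (F j₀ : 𝔸) := by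
    rw [fedAvg, ← hudef, Units.val_mul]
  have hb := norm_mlog_mul_sub_le huinv (hF1 j₀) (by linarith) (by linarith)
  have hlogXinv : mlog ((u⁻¹ : 𝔸ˣ) : 𝔸) = -mlog (u : 𝔸) :=
    ExpMeanLog.mlog_eq_neg_of_mul_eq_one (Units.mul_inv _) (hX.trans (by linarith))
  have hXval : (u : 𝔸) = fedSol W := by rw [hudef, val_fedUnit]
  -- (c) `log W_j = log(𝐔_j 𝐔₀⁻¹) ≈ log 𝐔_j − log 𝐔₀`
  have hlogF0inv : mlog (((F j₀)⁻¹ : 𝔸ˣ) : 𝔸) = -mlog ((F j₀ : 𝔸ˣ) : 𝔸) :=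
    ExpMeanLog.mlog_eq_neg_of_mul_eq_one (Units.mul_inv _) ((hF1 j₀).trans (by linarith))
  have hc : ∀ j, ‖mlog (W j) - (mlog ((F j : 𝔸ˣ) : 𝔸) - mlog ((F j₀ : 𝔸ˣ) : 𝔸))‖ ≤ 4 * (δ + δ) ^ 2 := by
    intro j
    have h := norm_mlog_mul_sub_le (hF1 j) hF0inv (by linarith) (by linarith)
    rw [hlogF0inv] at h
    have hWj : W j = (F j : 𝔸) * (((F j₀)⁻¹ : 𝔸ˣ) : 𝔸) := rfl
    have e : mlog (W j) - (mlog ((F j : 𝔸ˣ) : 𝔸) - mlog ((F j₀ : 𝔸ˣ) : 𝔸))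
        = mlog ((F j : 𝔸) * (((F j₀)⁻¹ : 𝔸ˣ) : 𝔸)) - mlog ((F j : 𝔸ˣ) : 𝔸) - -mlog ((F j₀ : 𝔸ˣ) : 𝔸) := by
      rw [hWj]; abel
    rw [e]
    exact h
  have hmean : ‖(Fintype.card ι : ℂ)⁻¹ • ∑ j, mlog (W j)
      - ((Fintype.card ι : ℂ)⁻¹ • ∑ j, mlog ((F j : 𝔸ˣ) : 𝔸) - mlog ((F j₀ : 𝔸ˣ) : 𝔸))‖ ≤ 4 * (δ + δ) ^ 2 := by
    have heq : (Fintype.card ι : ℂ)⁻¹ • ∑ j, mlog (W j)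
        - ((Fintype.card ι : ℂ)⁻¹ • ∑ j, mlog ((F j : 𝔸ˣ) : 𝔸) - mlog ((F j₀ : 𝔸ˣ) : 𝔸))
        = (Fintype.card ι : ℂ)⁻¹ • ∑ j, (mlog (W j) - (mlog ((F j : 𝔸ˣ) : 𝔸) - mlog ((F j₀ : 𝔸ˣ) : 𝔸))) := by
      rw [← avg_const (ι := ι) (mlog ((F j₀ : 𝔸ˣ) : 𝔸))]
      simp only [Finset.sum_sub_distrib, smul_sub, avg_const]
    rw [heq]
    exact norm_avg_le hc
  -- assembly
  have key : mlog ((fedAvg F j₀ : 𝔸ˣ) : 𝔸) - (Fintype.card ι : ℂ)⁻¹ • ∑ j, mlog ((F j : 𝔸ˣ) : 𝔸)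
      = (mlog (((u⁻¹ : 𝔸ˣ) : 𝔸) * (F j₀ : 𝔸)) - mlog ((u⁻¹ : 𝔸ˣ) : 𝔸) - mlog ((F j₀ : 𝔸ˣ) : 𝔸))
        - (mlog (fedSol W) + fed W 1)
        + ((Fintype.card ι : ℂ)⁻¹ • ∑ j, mlog (W j)
            - ((Fintype.card ι : ℂ)⁻¹ • ∑ j, mlog ((F j : 𝔸ˣ) : 𝔸) - mlog ((F j₀ : 𝔸ˣ) : 𝔸))) := by
    rw [hM, hlogXinv, hXval, hfed1]
    abel
  rw [key]
  calc _ ≤ ‖mlog (((u⁻¹ : 𝔸ˣ) : 𝔸) * (F j₀ : 𝔸)) - mlog ((u⁻¹ : 𝔸ˣ) : 𝔸) - mlog ((F j₀ : 𝔸ˣ) : 𝔸)‖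
          + ‖mlog (fedSol W) + fed W 1‖
          + ‖(Fintype.card ι : ℂ)⁻¹ • ∑ j, mlog (W j)
              - ((Fintype.card ι : ℂ)⁻¹ • ∑ j, mlog ((F j : 𝔸ˣ) : 𝔸) - mlog ((F j₀ : 𝔸ˣ) : 𝔸))‖ :=
        (norm_add_le _ _).trans (add_le_add (norm_sub_le _ _) le_rfl)
    _ ≤ 4 * (4 * (2 * δ) + δ) ^ 2 + 35 * (2 * δ) ^ 2 + 4 * (δ + δ) ^ 2 := add_le_add (add_le_add hb ha) hmean
    _ ≤ 500 * δ ^ 2 := by nlinarith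

end Mean

/-! ## § 4  (0.5) for the averaged contour variables (0.11): the reversed family `{U(−Γ)}_{Γ∈𝐆(q,x)}` -/

section Contours

variable {𝔸 : Type*} [NormedRing 𝔸] [NormedAlgebra ℂ 𝔸] [NormOneClass 𝔸] [CompleteSpace 𝔸] {L : ℕ}

/-- [cite: Balaban1987RG1, (0.12) p.254] **THE FACTOR `𝐔(x′, c₊)` OF (0.12) IS `𝐔(c₊, x′)⁻¹`**: the mean of the
reversed contours `{U(−Γ) = U(Γ)⁻¹}_{Γ∈𝐆(q,x)}` is the inverse of `𝐔(q,x) = M({U(Γ)}_{Γ∈𝐆(q,x)})` — (0.5) for the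
contour family, on an `ε₀`-regular `U1`-valued configuration with `(dL)²ε₀ ≤ 1/100`; this is the identity the
lineage's (0.12) loop `B12AverageCorridor267.loopW` takes as the READING of `𝐔(x′,c₊)` (`B12ContourAverage253`
DIVERGENCE (f)), now a theorem. -/
theorem fedAvg_permT_inv (hL : 0 < L) (U : ZdEdge d → 𝔸ˣ) (hU : ∀ b, U b ∈ U1 𝔸) {ε₀ : ℝ} (hε₀ : 0 ≤ ε₀)
    (hsm : ((d : ℝ) * L) ^ 2 * ε₀ ≤ 1 / 100)
    (h44 : ∀ (p : Fin d → ℤ) (i j : Fin d), i ≠ j → ‖((plaquetteHolonomyZd U p i j : 𝔸ˣ) : 𝔸) - 1‖ ≤ ε₀)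
    (x : Fin d → ℤ) :
    fedAvg (fun π : Equiv.Perm (Fin d) => (permT L U π x)⁻¹) 1 = (Tavg L U x)⁻¹ := by
  haveI : NeZero L := ⟨hL.ne'⟩
  have hx : x ∈ blockSites L (blockMap L x) := (mem_blockSites_iff L _ x).2 rfl
  have hF : ∀ π, permT L U π x ∈ U1 𝔸 := fun π =>
    permT_mem_U1 U (fun b => (mem_U1.mp (hU b)).1) (fun b => (mem_U1.mp (hU b)).2) π x
  have hrel : ∀ π, ‖rel (fun π : Equiv.Perm (Fin d) => permT L U π x) 1 π - 1‖ ≤ ((d : ℝ) * L) ^ 2 * ε₀ :=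
    fun π => rel_permT_small hL U (fun b => (mem_U1.mp (hU b)).1) (fun b => (mem_U1.mp (hU b)).2) hε₀ hx
      (fun p i j hij _ _ => h44 p i j hij) π
  rw [Tavg]
  exact fedAvg_inv_family hsm hF hrel

end Contours

end Literature.MathematicalPhysics.QuantumFieldTheory.Balaban1983to89.B12Average05And08

end
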